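import Literature.MathematicalPhysics.QuantumFieldTheory.Balaban1983to89.Node00.Record13NumericsOfThm1CCMW
import Literature.MathematicalPhysics.QuantumFieldTheory.Balaban1983to89.Node00.Record13LettersOfThm1CCM

/-!
# NODE 00 (YM-PLAN Track A) — STAGE 13: THE LETTERS OF THE GAUGE ROAD AT THE WINDOWED COLLARED WITNESS `θ₁₅ᶜᶜᴹ(j; γ) = theta13OfThm1CCMW F N j γ ε₀ ε₂₉ B₃ B₃' a₀ a₁` (`0 < γ ≤ ½`),
# THE PINS, ★ THE β TRANSFER «on the box `]0, γ]` the β-functions of record of `θ₁₅ᶜᶜᴹ(j; γ)` and of `θ₁₅ᶜᶜᴹ(j)` COINCIDE», and the two history clauses from the β-box ON `]0, γ]`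

Cell `pub-ymgap`, seat `pub-ymgap-dag-n21-c` (g12), pen (γ) «THE WITNESS RE-PIN» on plan g76's V15 stub 3′.  FILE A2ʷ (A1ʷ = `Node00/Record13NumericsOfThm1CCMW`: the windowed numerics
and witness).  NEW leaf, theorems only; A2 `Record13LettersOfThm1CCM` and node00-def-K0a's θ-generic FILES 13b∕13e∕14d∕14 CONSUMED BY NAME, nothing modified.  `--supports stmt-QuantumFields-20541`.
[15] = [Balaban1985Variational], [6] = [Balaban1985RegularSpaces], [III] = [Balaban1988Convergent], [I] = [Balaban1987RG1], [II] = [Balaban1989LargeFieldII], [IV] = [Balaban1989LargeFieldI].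

WHAT THIS FILE PROVES (theorems only; 0 `def`).
* §3 every gauge-road letter of FILE 21 §2's binder list at `θ₁₅ᶜᶜᴹ(j; γ)` along every `γ`-windowed run, for `γ ≤ ½` (the letters read the window only through `g_m ≤ γ ≤ ½`:
  `g² ≤ e⁻¹`, `log g⁻² > 1`, `ε(g_m) ≤ 2ε(g_{m+1})` for `g_m ≤ g_{m+1} ≤ ½`, `α₀(g) > 0` for `g < 1`): `hnum_`, `εreg_le_`, `hε0_`, `hg_`, `hpq_`, `hα0_`, `hBα_`, `hC1_`, `hcomp_…_of_monotone`,
  `htI_`, `htMS_` (+ the `γ`-blind constant inequalities, which ARE A2's by `rfl`).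
* §4 the pins and ★ the collar ∕ non-wrapping letters — `γ`-BLIND, hence A2's theorems re-read at `θ₁₅ᶜᶜᴹ(j; γ)` (`τ9.M = ν.M₁ = L^j` by `rfl` on both members): `hM_`, `hM₁_`,
  `collar_le_M₁_theta13OfThm1CCMW (hj : 3 ≤ j)`, `hsN_theta13OfThm1CCMW (hjm : j + 1 ≤ F.m)`, `hsN_theta13OfThm1CCMW_iff : hsN ↔ j + 1 ≤ F.m` ((δ) is window-blind).
* §5 ★★ THE β TRANSFER: `betaOfRecord₁₃_theta13OfThm1CCMW_eq_of_mem (hγ : γ ≤ ½) (hv : v ∈ Box γ k) : β₁₃(θ₁₅ᶜᶜᴹ(j; γ)) k v = β₁₃(θ₁₅ᶜᶜᴹ(j)) k v` — the two witnesses share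
  `ν, ε₂₉, εbg, ρ8, bV, v₀` and the transport, so their MERGED β ([I] (1.20)–(1.22) on (1.6)) is literally the same function and the box conventions agree on `]0, γ] ⊆ ]0, ½]`;
  hence `betaLowerH_theta13OfThm1CCMW_of_half`, `betaUpperH_theta13OfThm1CCMW_of_half`: a β-box of A1's witness ON THE SMALLER BOX `]0, γ]` IS a β-box of the window edition on its
  own window.  §6 the two history clauses at `θ₁₅ᶜᶜᴹ(j; γ)` from the β-box on `]0, γ]` (13e ∕ 14d θ-generic; the (14d) letter is `β′·γ² ≤ ¾`, weaker than `β′ ≤ 3` for `γ ≤ ½`),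
  and ★ from the β-box OF A1's WITNESS on `]0, γ]` (§5 ∘ §6).

HONEST FRAMING.  One-line instantiations, a `rfl`-level transfer and elementary arithmetic; nothing of Bałaban asserted; NOT a discharge; K0⁷ NOT closed (V15 stubs 1∕2∕3′∕4 untouched —
this file PREPARES the weakening of stub 3′ from the window `½` to «some window `γ ∈ ]0, ½]`», filed as Bʷ∕Cʷ); counts unmoved (typed 28∕28 · discharged 5∕27); one finite 𝕋⁴ programme at
fixed ε — NOT continuum ∕ OS ∕ mass gap ∕ Clay.  No `sorry`, no `axiom`, no `def`, no `instance`, no `notation`.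
-/

noncomputable section

open MeasureTheory
open scoped Matrix.Norms.L2Operator

namespace Literature.MathematicalPhysics.QuantumFieldTheory.Balaban1983to89.Node00

open T4Continuum B14.Eq218Concrete B15DeterminingSets B12RegularSpaces111 B14RegularSpaces234 FlowStep FlowStepRuns

/-! ## §3. The letters of the GAUGE road at `θ₁₅ᶜᶜᴹ(j; γ)`, along every `γ`-windowed run, `γ ≤ ½` -/

section Faces

variable {F : T4Family} {N : ℕ} [NeZero N] {j : ℕ} {γ ε₀ ε₂₉ B₃ B₃' a₀ a₁ : ℝ}

/-- **(hnum) AT `θ₁₅ᶜᶜᴹ(j; γ)`** (`γ ≤ ½ < 1`): `0 < cR·ε_m ≤ a₁`, `B₃·cR·ε_m ≤ εreg = a₀` along every windowed run (13a's window lemma; thresholds window-blind).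
[cite: Balaban1988Convergent, (2.4) p.255, (2.12) p.256; Balaban1985Variational, Thm 1 (7)–(8) p.279] -/
theorem hnum_theta13OfThm1CCMW (hγ : γ ≤ 1 / 2) (hB : 0 ≤ B₃) (hB' : 0 ≤ B₃') (ha₀ : 0 < a₀) (ha₁ : 0 < a₁) :
     ∀ (p : B12.RunParams) (n : ℕ), n ≤ p.K → Step.InInterval (theta13OfThm1CCMW F N j γ ε₀ ε₂₉ B₃ B₃' a₀ a₁).γ n (gOfRecord₁₃ F N (theta13OfThm1CCMW F N j γ ε₀ ε₂₉ B₃ B₃' a₀ a₁) p) → ∀ m, m ≤ n →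
      0 < (theta13OfThm1CCMW F N j γ ε₀ ε₂₉ B₃ B₃' a₀ a₁).s2.cR * epsOfRecord (theta13OfThm1CCMW F N j γ ε₀ ε₂₉ B₃ B₃' a₀ a₁).ν (gOfRecord₁₃ F N (theta13OfThm1CCMW F N j γ ε₀ ε₂₉ B₃ B₃' a₀ a₁) p) m ∧ (theta13OfThm1CCMW F N j γ ε₀ ε₂₉ B₃ B₃' a₀ a₁).s2.cR * epsOfRecord (theta13OfThm1CCMW F N j γ ε₀ ε₂₉ B₃ B₃' a₀ a₁).ν (gOfRecord₁₃ F N (theta13OfThm1CCMW F N j γ ε₀ ε₂₉ B₃ B₃' a₀ a₁) p) m ≤ a₁ ∧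
        B₃ * ((theta13OfThm1CCMW F N j γ ε₀ ε₂₉ B₃ B₃' a₀ a₁).s2.cR * epsOfRecord (theta13OfThm1CCMW F N j γ ε₀ ε₂₉ B₃ B₃' a₀ a₁).ν (gOfRecord₁₃ F N (theta13OfThm1CCMW F N j γ ε₀ ε₂₉ B₃ B₃' a₀ a₁) p) m) ≤ (theta13OfThm1CCMW F N j γ ε₀ ε₂₉ B₃ B₃' a₀ a₁).ν.εreg :=
  fun _ _ _ hw => numerics_thm1CC1_of_inInterval (L := F.L) (ε₀ := ε₀) hB hB' ha₀ ha₁ (hγ.trans_lt (by norm_num) : γ < 1) hw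

/-- `θ₁₅ᶜᶜᴹ(j; γ).ν.εreg ≤ a₀` (it IS `a₀`). [cite: Balaban1985Variational, Thm 1 (8) p.279 (bookkeeping)] -/
theorem εreg_le_theta13OfThm1CCMW : (theta13OfThm1CCMW F N j γ ε₀ ε₂₉ B₃ B₃' a₀ a₁).ν.εreg ≤ a₀ := (theta13OfThm1CCMW_εreg F N j γ ε₀ ε₂₉ B₃ B₃' a₀ a₁).le

/-- **`0 ≤ cR·ε_m` AT `θ₁₅ᶜᶜᴹ(j; γ)`** along every windowed run. [cite: Balaban1988Convergent, (2.4) p.255, (2.10) p.256 (bookkeeping)] -/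
theorem hε0_theta13OfThm1CCMW (hγ : γ ≤ 1 / 2) (hB : 0 ≤ B₃) (hB' : 0 ≤ B₃') (ha₀ : 0 < a₀) (ha₁ : 0 < a₁) :
     ∀ (p : B12.RunParams) (n : ℕ), n ≤ p.K → Step.InInterval (theta13OfThm1CCMW F N j γ ε₀ ε₂₉ B₃ B₃' a₀ a₁).γ n (gOfRecord₁₃ F N (theta13OfThm1CCMW F N j γ ε₀ ε₂₉ B₃ B₃' a₀ a₁) p) → ∀ m, m ≤ n → 0 ≤ (theta13OfThm1CCMW F N j γ ε₀ ε₂₉ B₃ B₃' a₀ a₁).s2.cR * epsOfRecord (theta13OfThm1CCMW F N j γ ε₀ ε₂₉ B₃ B₃' a₀ a₁).ν (gOfRecord₁₃ F N (theta13OfThm1CCMW F N j γ ε₀ ε₂₉ B₃ B₃' a₀ a₁) p) m :=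
  fun p n hn hw m hm => (hnum_theta13OfThm1CCMW hγ hB hB' ha₀ ha₁ p n hn hw m hm).1.le

/-- **THE WINDOW LETTERS AT `θ₁₅ᶜᶜᴹ(j; γ)`** (`γ ≤ ½`): `0 < g_m`, `g_m² ≤ e⁻¹` along every windowed run. [cite: Balaban1987RG1, Thm 1 p.259; Balaban1988Convergent, (2.4) p.255 (bookkeeping)] -/
theorem hg_theta13OfThm1CCMW (hγ : γ ≤ 1 / 2) :
     ∀ (p : B12.RunParams) (n : ℕ), n ≤ p.K → Step.InInterval (theta13OfThm1CCMW F N j γ ε₀ ε₂₉ B₃ B₃' a₀ a₁).γ n (gOfRecord₁₃ F N (theta13OfThm1CCMW F N j γ ε₀ ε₂₉ B₃ B₃' a₀ a₁) p) → ∀ m, m ≤ n → 0 < gOfRecord₁₃ F N (theta13OfThm1CCMW F N j γ ε₀ ε₂₉ B₃ B₃' a₀ a₁) p m ∧ gOfRecord₁₃ F N (theta13OfThm1CCMW F N j γ ε₀ ε₂₉ B₃ B₃' a₀ a₁) p m ^ 2 ≤ Real.exp (-1) :=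
  fun _ _ _ hw => window_sq_le_of_inInterval ((theta13OfThm1CCMW_γ F N j γ ε₀ ε₂₉ B₃ B₃' a₀ a₁).trans_le hγ) hw

/-- **`p₀ ≤ q₀` AT `θ₁₅ᶜᶜᴹ(j; γ)`** (`1 ≤ 2`). [cite: Balaban1988Convergent, (2.4) p.255, (2.28) p.259 (bookkeeping)] -/
theorem hpq_theta13OfThm1CCMW : (theta13OfThm1CCMW F N j γ ε₀ ε₂₉ B₃ B₃' a₀ a₁).ν.p₀ ≤ (lfOfRecord₁₂ F N (theta13OfThm1CCMW F N j γ ε₀ ε₂₉ B₃ B₃' a₀ a₁).toStage12Params).q₀ := by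
  rw [theta13OfThm1CCMW_p₀, lfOfRecord₁₂_theta13OfThm1CCMW]; norm_num [lfConstsOfFamily, lfConstsOfRecord₁₂]

/-- **`α₀(g_m) > 0` AT `θ₁₅ᶜᶜᴹ(j; γ)`** along every windowed run (`C₀ = 1 > 0`, `0 < g_m ≤ γ ≤ ½ < 1`). [cite: Balaban1988Convergent, (2.28) p.259 (bookkeeping)] -/
theorem hα0_theta13OfThm1CCMW (hγ : γ ≤ 1 / 2) :
    ∀ (p : B12.RunParams) (n : ℕ), n ≤ p.K → Step.InInterval (theta13OfThm1CCMW F N j γ ε₀ ε₂₉ B₃ B₃' a₀ a₁).γ n (gOfRecord₁₃ F N (theta13OfThm1CCMW F N j γ ε₀ ε₂₉ B₃ B₃' a₀ a₁) p) → ∀ m, m ≤ n →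
      0 < (lfOfRecord₁₂ F N (theta13OfThm1CCMW F N j γ ε₀ ε₂₉ B₃ B₃' a₀ a₁).toStage12Params).alpha0 (gOfRecord₁₃ F N (theta13OfThm1CCMW F N j γ ε₀ ε₂₉ B₃ B₃' a₀ a₁) p m) :=
  fun p n _ hw m hm => alpha0_pos_of_lt_one _ (by rw [lfOfRecord₁₂_theta13OfThm1CCMW]; norm_num [lfConstsOfFamily, lfConstsOfRecord₁₂]) (hw m hm).1
    ((hw m hm).2.trans_lt ((theta13OfThm1CCMW_γ F N j γ ε₀ ε₂₉ B₃ B₃' a₀ a₁).trans_lt (hγ.trans_lt (by norm_num))))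

/-- `0 ≤ B₃·cR·A₀` at `θ₁₅ᶜᶜᴹ(j; γ)` (window-blind: A2's at `θ₁₅ᶜᶜᴹ(j)`). [cite: Balaban1988Convergent, (2.28) p.259 (bookkeeping)] -/
theorem mul_A0_nonneg_thm1CCMW (hB : 0 ≤ B₃) (hB' : 0 ≤ B₃') (ha₀ : 0 ≤ a₀) (ha₁ : 0 ≤ a₁) :
    0 ≤ B₃ * (theta13OfThm1CCMW F N j γ ε₀ ε₂₉ B₃ B₃' a₀ a₁).s2.cR * (theta13OfThm1CCMW F N j γ ε₀ ε₂₉ B₃ B₃' a₀ a₁).ν.A₀ :=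
  mul_A0_nonneg_thm1CCM (F := F) (N := N) (j := j) (ε₀ := ε₀) (ε₂₉ := ε₂₉) hB hB' ha₀ ha₁

/-- The «C₀ sufficiently large» inequality of (2.34) at `θ₁₅ᶜᶜᴹ(j; γ)`: `B₃·cR·A₀ᶜᶜ¹ ≤ (1 − β)·C₀` (window-blind). [cite: Balaban1988Convergent, (2.28) p.259, (2.34) p.261] -/
theorem mul_A0_le_C₀_thm1CCMW (hB : 0 ≤ B₃) (hB' : 0 ≤ B₃') (ha₀ : 0 ≤ a₀) (ha₁ : 0 ≤ a₁) :
    B₃ * (theta13OfThm1CCMW F N j γ ε₀ ε₂₉ B₃ B₃' a₀ a₁).s2.cR * (theta13OfThm1CCMW F N j γ ε₀ ε₂₉ B₃ B₃' a₀ a₁).ν.A₀ ≤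
      (1 - (theta13OfThm1CCMW F N j γ ε₀ ε₂₉ B₃ B₃' a₀ a₁).s2.βc) * (lfOfRecord₁₂ F N (theta13OfThm1CCMW F N j γ ε₀ ε₂₉ B₃ B₃' a₀ a₁).toStage12Params).C₀ := by
  rw [theta13OfThm1CCMW_cR, mul_one, theta13OfThm1CCMW_A₀, theta13OfThm1CCMW_βc, lfOfRecord₁₂_theta13OfThm1CCMW]
  have h := mul_A0OfThm1CC1_le (L := F.L) hB hB' ha₀ ha₁
  norm_num [lfConstsOfFamily, lfConstsOfRecord₁₂]
  linarith

/-- **(hBα) AT `θ₁₅ᶜᶜᴹ(j; γ)`** (`bg_numerics_of_letters`: `p₀ = 1 ≤ q₀ = 2`, `B₃·A₀ᶜᶜ¹ ≤ ¾·C₀`, `g_m² ≤ e⁻¹`). [cite: Balaban1988Convergent, (2.4) p.255, (2.28) p.259, (2.34) p.261] -/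
theorem hBα_theta13OfThm1CCMW (hγ : γ ≤ 1 / 2) (hB : 0 ≤ B₃) (hB' : 0 ≤ B₃') (ha₀ : 0 ≤ a₀) (ha₁ : 0 ≤ a₁) :
     ∀ (p : B12.RunParams) (n : ℕ), n ≤ p.K → Step.InInterval (theta13OfThm1CCMW F N j γ ε₀ ε₂₉ B₃ B₃' a₀ a₁).γ n (gOfRecord₁₃ F N (theta13OfThm1CCMW F N j γ ε₀ ε₂₉ B₃ B₃' a₀ a₁) p) → ∀ m, 1 ≤ m → m ≤ n →
      B₃ * ((theta13OfThm1CCMW F N j γ ε₀ ε₂₉ B₃ B₃' a₀ a₁).s2.cR * epsOfRecord (theta13OfThm1CCMW F N j γ ε₀ ε₂₉ B₃ B₃' a₀ a₁).ν (gOfRecord₁₃ F N (theta13OfThm1CCMW F N j γ ε₀ ε₂₉ B₃ B₃' a₀ a₁) p) m) ≤ (1 - (theta13OfThm1CCMW F N j γ ε₀ ε₂₉ B₃ B₃' a₀ a₁).s2.βc) * (lfOfRecord₁₂ F N (theta13OfThm1CCMW F N j γ ε₀ ε₂₉ B₃ B₃' a₀ a₁).toStage12Params).alpha0 (gOfRecord₁₃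 F N (theta13OfThm1CCMW F N j γ ε₀ ε₂₉ B₃ B₃' a₀ a₁) p m) :=
  fun p n _ hw =>
    (theta13OfThm1CCMW F N j γ ε₀ ε₂₉ B₃ B₃' a₀ a₁).bg_numerics_of_letters hpq_theta13OfThm1CCMW
      (mul_A0_nonneg_thm1CCMW hB hB' ha₀ ha₁) (mul_A0_le_C₀_thm1CCMW hB hB' ha₀ ha₁) p n (hg_theta13OfThm1CCMW hγ p n ‹_› hw)

/-- **(C1) NESTED GRIDS AT `θ₁₅ᶜᶜᴹ(j; γ)`**: `R_m = L·t_m` along every windowed run (`L ≥ 2`, `r = 1`, `log g_m⁻² > 1` in `]0, γ] ⊆ ]0, ½]`). [cite: Balaban1988Convergent, (2.5) p.255, p.257] -/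
theorem hC1_theta13OfThm1CCMW (hγ : γ ≤ 1 / 2) :
     ∀ (p : B12.RunParams) (n : ℕ), n ≤ p.K → Step.InInterval (theta13OfThm1CCMW F N j γ ε₀ ε₂₉ B₃ B₃' a₀ a₁).γ n (gOfRecord₁₃ F N (theta13OfThm1CCMW F N j γ ε₀ ε₂₉ B₃ B₃' a₀ a₁) p) → ∀ m, 1 ≤ m → m ≤ n →
      ∃ t : ℕ, 0 < t ∧ RkOfRecord (F.P p.K).L (theta13OfThm1CCMW F N j γ ε₀ ε₂₉ B₃ B₃' a₀ a₁).ν.r (gOfRecord₁₃ F N (theta13OfThm1CCMW F N j γ ε₀ ε₂₉ B₃ B₃' a₀ a₁) p m) = (F.P p.K).L * t := by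
  intro p n _ hw m _ hm
  have hL : 2 ≤ (F.P p.K).L := by show 2 ≤ F.L; have := F.hL11; omega
  exact exists_RkOfRecord_eq_mul hL (le_of_eq (theta13OfThm1CCMW_r F N j γ ε₀ ε₂₉ B₃ B₃' a₀ a₁).symm)
    (one_lt_log_inv_sq_of_le_half (hw m hm).1 ((hw m hm).2.trans ((theta13OfThm1CCMW_γ F N j γ ε₀ ε₂₉ B₃ B₃' a₀ a₁).trans_le hγ)))

/-- **(hcomp) AT `θ₁₅ᶜᶜᴹ(j; γ)` from the MONOTONICITY of the windowed history** (`cR·ε_m ≤ 2·cR·ε_{m+1}`; `p₀ = 1`, `A₀ ≥ 0`, `g_{m+1} ≤ γ ≤ ½`).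
[cite: Balaban1988Convergent, (2.4) p.255, (2.7)–(2.8) pp.255–256; Balaban1987RG1, Thm 1 p.259] -/
theorem hcomp_theta13OfThm1CCMW_of_monotone (hγ : γ ≤ 1 / 2) (hB : 0 ≤ B₃) (hB' : 0 ≤ B₃') (ha₀ : 0 ≤ a₀) (ha₁ : 0 ≤ a₁)
    (hmono : ∀ (p : B12.RunParams) (n : ℕ), n ≤ p.K → Step.InInterval (theta13OfThm1CCMW F N j γ ε₀ ε₂₉ B₃ B₃' a₀ a₁).γ n (gOfRecord₁₃ F N (theta13OfThm1CCMW F N j γ ε₀ ε₂₉ B₃ B₃' a₀ a₁) p) → ∀ m, m < n →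
      gOfRecord₁₃ F N (theta13OfThm1CCMW F N j γ ε₀ ε₂₉ B₃ B₃' a₀ a₁) p m ≤ gOfRecord₁₃ F N (theta13OfThm1CCMW F N j γ ε₀ ε₂₉ B₃ B₃' a₀ a₁) p (m + 1)) :
     ∀ (p : B12.RunParams) (n : ℕ), n ≤ p.K → Step.InInterval (theta13OfThm1CCMW F N j γ ε₀ ε₂₉ B₃ B₃' a₀ a₁).γ n (gOfRecord₁₃ F N (theta13OfThm1CCMW F N j γ ε₀ ε₂₉ B₃ B₃' a₀ a₁) p) → ∀ m, m < n →
      (theta13OfThm1CCMW F N j γ ε₀ ε₂₉ B₃ B₃' a₀ a₁).s2.cR * epsOfRecord (theta13OfThm1CCMW F N j γ ε₀ ε₂₉ B₃ B₃' a₀ a₁).ν (gOfRecord₁₃ F N (theta13OfThm1CCMW F N j γ ε₀ ε₂₉ B₃ B₃' a₀ a₁) p) m ≤ 2 * ((theta13OfThm1CCMW F N j γ ε₀ ε₂₉ B₃ B₃' a₀ a₁).s2.cR * epsOfRecord (theta13OfThm1CCMW F N j γ ε₀ ε₂₉ B₃ B₃' a₀ a₁).ν (gOfRecord₁₃ F N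 (theta13OfThm1CCMW F N j γ ε₀ ε₂₉ B₃ B₃' a₀ a₁) p) (m + 1)) := by
  intro p n hn hw m hm
  rw [theta13OfThm1CCMW_cR, one_mul, one_mul]
  have hγ' := theta13OfThm1CCMW_γ F N j γ ε₀ ε₂₉ B₃ B₃' a₀ a₁
  have h0 : 0 < gOfRecord₁₃ F N (theta13OfThm1CCMW F N j γ ε₀ ε₂₉ B₃ B₃' a₀ a₁) p m := (hw m hm.le).1
  have hhalf : gOfRecord₁₃ F N (theta13OfThm1CCMW F N j γ ε₀ ε₂₉ B₃ B₃' a₀ a₁) p (m + 1) ≤ 1 / 2 := ((hw (m + 1) hm).2.trans hγ'.le).trans hγ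
  exact epsOfRecord_le_two_mul_of_le _ (theta13OfThm1CCMW_p₀ F N j γ ε₀ ε₂₉ B₃ B₃' a₀ a₁)
    (by rw [theta13OfThm1CCMW_A₀]; exact A0OfThm1CC1_nonneg hB hB' ha₀ ha₁) h0 (hmono p n hn hw m hm) hhalf

/-- `0 ≤ B₃′·cR·A₀` at `θ₁₅ᶜᶜᴹ(j; γ)` (window-blind). [cite: Balaban1988Convergent, (2.28) p.259 (bookkeeping)] -/
theorem gauge_mul_A0_nonneg_thm1CCMW (hB : 0 ≤ B₃) (hB' : 0 ≤ B₃') (ha₀ : 0 ≤ a₀) (ha₁ : 0 ≤ a₁) :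
    0 ≤ B₃' * (theta13OfThm1CCMW F N j γ ε₀ ε₂₉ B₃ B₃' a₀ a₁).s2.cR * (theta13OfThm1CCMW F N j γ ε₀ ε₂₉ B₃ B₃' a₀ a₁).ν.A₀ :=
  gauge_mul_A0_nonneg_thm1CCM (F := F) (N := N) (j := j) (ε₀ := ε₀) (ε₂₉ := ε₂₉) hB hB' ha₀ ha₁

/-- **«C₀ sufficiently large» FOR THE I-FAMILY GAUGES at `θ₁₅ᶜᶜᴹ(j; γ)`**: `B₃′·cR·A₀ ≤ cB·C₀` (window-blind). [cite: Balaban1987RG1, (1.12) p.262; Balaban1988Convergent, (2.28) p.259] -/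
theorem gauge_mul_A0_le_cB_C₀_thm1CCMW (hB : 0 ≤ B₃) (hB' : 0 ≤ B₃') (ha₀ : 0 ≤ a₀) (ha₁ : 0 ≤ a₁) :
    B₃' * (theta13OfThm1CCMW F N j γ ε₀ ε₂₉ B₃ B₃' a₀ a₁).s2.cR * (theta13OfThm1CCMW F N j γ ε₀ ε₂₉ B₃ B₃' a₀ a₁).ν.A₀ ≤ (theta13OfThm1CCMW F N j γ ε₀ ε₂₉ B₃ B₃' a₀ a₁).s2.cB * (lfOfRecord₁₂ F N (theta13OfThm1CCMW F N j γ ε₀ ε₂₉ B₃ B₃' a₀ a₁).toStage12Params).C₀ := by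
  rw [theta13OfThm1CCMW_cR, mul_one, theta13OfThm1CCMW_A₀, theta13OfThm1CCMW_cB, lfOfRecord₁₂_theta13OfThm1CCMW]
  have h1 : (1 : ℝ) ≤ F.L := by exact_mod_cast F.hL.2.le
  have h := gauge_mul_A0OfThm1CC1_le (L := F.L) F.hL.2.le hB hB' ha₀ ha₁
  norm_num [lfConstsOfFamily, lfConstsOfRecord₁₂]
  nlinarith

/-- **«C₀ sufficiently large» FOR THE MS-FAMILY GAUGES at `θ₁₅ᶜᶜᴹ(j; γ)`**: `B₃′·cR·A₀ ≤ B·C·M_r·C₀` (window-blind). [cite: Balaban1988Convergent, (2.38) p.261, (2.28) p.259] -/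
theorem gauge_mul_A0_le_BCM_C₀_thm1CCMW (hB : 0 ≤ B₃) (hB' : 0 ≤ B₃') (ha₀ : 0 ≤ a₀) (ha₁ : 0 ≤ a₁) :
    B₃' * (theta13OfThm1CCMW F N j γ ε₀ ε₂₉ B₃ B₃' a₀ a₁).s2.cR * (theta13OfThm1CCMW F N j γ ε₀ ε₂₉ B₃ B₃' a₀ a₁).ν.A₀ ≤ (theta13OfThm1CCMW F N j γ ε₀ ε₂₉ B₃ B₃' a₀ a₁).s2.B * (theta13OfThm1CCMW F N j γ ε₀ ε₂₉ B₃ B₃' a₀ a₁).s2.C * (theta13OfThm1CCMW F N j γ ε₀ ε₂₉ B₃ B₃' a₀ a₁).s2.Mr * (lfOfRecord₁₂ F N (theta13OfThm1CCMW F N j γ ε₀ ε₂₉ B₃ B₃' a₀ a₁).toStage12Params).C₀ := by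
  rw [theta13OfThm1CCMW_cR, mul_one, theta13OfThm1CCMW_A₀, theta13OfThm1CCMW_B, theta13OfThm1CCMW_C, theta13OfThm1CCMW_Mr, lfOfRecord₁₂_theta13OfThm1CCMW]
  have h := gauge_mul_A0OfThm1CC1_le (L := F.L) F.hL.2.le hB hB' ha₀ ha₁
  norm_num [lfConstsOfFamily, lfConstsOfRecord₁₂]
  linarith

/-- **★ THE I-FAMILY RADIUS LETTER `htI` ALONG EVERY WINDOWED RUN AT `θ₁₅ᶜᶜᴹ(j; γ)`**: `B₃′·(cR·ε_m) ≤ cB·α₀(g_m)`, `1 ≤ m ≤ n` (FILE 14 `gaugeLetter_of_numerics`).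
[cite: Balaban1987RG1, (1.12) p.262; Balaban1988Convergent, (2.4) p.255, (2.28) p.259] -/
theorem htI_theta13OfThm1CCMW (hγ : γ ≤ 1 / 2) (hB : 0 ≤ B₃) (hB' : 0 ≤ B₃') (ha₀ : 0 ≤ a₀) (ha₁ : 0 ≤ a₁) :
    ∀ (p : B12.RunParams) (n : ℕ), n ≤ p.K → Step.InInterval (theta13OfThm1CCMW F N j γ ε₀ ε₂₉ B₃ B₃' a₀ a₁).γ n (gOfRecord₁₃ F N (theta13OfThm1CCMW F N j γ ε₀ ε₂₉ B₃ B₃' a₀ a₁) p) → ∀ m, 1 ≤ m → m ≤ n →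
      B₃' * ((theta13OfThm1CCMW F N j γ ε₀ ε₂₉ B₃ B₃' a₀ a₁).s2.cR * epsOfRecord (theta13OfThm1CCMW F N j γ ε₀ ε₂₉ B₃ B₃' a₀ a₁).ν (gOfRecord₁₃ F N (theta13OfThm1CCMW F N j γ ε₀ ε₂₉ B₃ B₃' a₀ a₁) p) m) ≤
        (theta13OfThm1CCMW F N j γ ε₀ ε₂₉ B₃ B₃' a₀ a₁).s2.cB * (lfOfRecord₁₂ F N (theta13OfThm1CCMW F N j γ ε₀ ε₂₉ B₃ B₃' a₀ a₁).toStage12Params).alpha0 (gOfRecord₁₃ F N (theta13OfThm1CCMW F N j γ ε₀ ε₂₉ B₃ B₃' a₀ a₁) p m) :=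
  fun p n hn hw => gaugeLetter_of_numerics (lfOfRecord₁₂ F N (theta13OfThm1CCMW F N j γ ε₀ ε₂₉ B₃ B₃' a₀ a₁).toStage12Params) (theta13OfThm1CCMW F N j γ ε₀ ε₂₉ B₃ B₃' a₀ a₁).ν
    (fun m _ hm => hg_theta13OfThm1CCMW hγ p n hn hw m hm) hpq_theta13OfThm1CCMW (gauge_mul_A0_nonneg_thm1CCMW hB hB' ha₀ ha₁) (gauge_mul_A0_le_cB_C₀_thm1CCMW hB hB' ha₀ ha₁)

/-- **★ THE MS-FAMILY RADIUS LETTER `htMS` ALONG EVERY WINDOWED RUN AT `θ₁₅ᶜᶜᴹ(j; γ)`**: `B₃′·(cR·ε_m) ≤ B·C·M_r·α₀(g_m)`, `1 ≤ m ≤ n`. [cite: Balaban1988Convergent, (2.38) p.261, (2.4) p.255, (2.28) p.259] -/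
theorem htMS_theta13OfThm1CCMW (hγ : γ ≤ 1 / 2) (hB : 0 ≤ B₃) (hB' : 0 ≤ B₃') (ha₀ : 0 ≤ a₀) (ha₁ : 0 ≤ a₁) :
    ∀ (p : B12.RunParams) (n : ℕ), n ≤ p.K → Step.InInterval (theta13OfThm1CCMW F N j γ ε₀ ε₂₉ B₃ B₃' a₀ a₁).γ n (gOfRecord₁₃ F N (theta13OfThm1CCMW F N j γ ε₀ ε₂₉ B₃ B₃' a₀ a₁) p) → ∀ m, 1 ≤ m → m ≤ n →
      B₃' * ((theta13OfThm1CCMW F N j γ ε₀ ε₂₉ B₃ B₃' a₀ a₁).s2.cR * epsOfRecord (theta13OfThm1CCMW F N j γ ε₀ ε₂₉ B₃ B₃' a₀ a₁).ν (gOfRecord₁₃ F N (theta13OfThm1CCMW F N j γ ε₀ ε₂₉ B₃ B₃' a₀ a₁) p) m) ≤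
        (theta13OfThm1CCMW F N j γ ε₀ ε₂₉ B₃ B₃' a₀ a₁).s2.B * (theta13OfThm1CCMW F N j γ ε₀ ε₂₉ B₃ B₃' a₀ a₁).s2.C * (theta13OfThm1CCMW F N j γ ε₀ ε₂₉ B₃ B₃' a₀ a₁).s2.Mr * (lfOfRecord₁₂ F N (theta13OfThm1CCMW F N j γ ε₀ ε₂₉ B₃ B₃' a₀ a₁).toStage12Params).alpha0 (gOfRecord₁₃ F N (theta13OfThm1CCMW F N j γ ε₀ ε₂₉ B₃ B₃' a₀ a₁) p m) :=
  fun p n hn hw => gaugeLetter_of_numerics (lfOfRecord₁₂ F N (theta13OfThm1CCMW F N j γ ε₀ ε₂₉ B₃ B₃' a₀ a₁).toStage12Params) (theta13OfThm1CCMW F N j γ ε₀ ε₂₉ B₃ B₃' a₀ a₁).ν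
    (fun m _ hm => hg_theta13OfThm1CCMW hγ p n hn hw m hm) hpq_theta13OfThm1CCMW (gauge_mul_A0_nonneg_thm1CCMW hB hB' ha₀ ha₁) (gauge_mul_A0_le_BCM_C₀_thm1CCMW hB hB' ha₀ ha₁)

end Faces

/-! ## §4. The pins, the collar letter and the non-wrapping letter at `θ₁₅ᶜᶜᴹ(j; γ)` — window-blind (A2's theorems re-read; `τ9.M = ν.M₁ = L^j` by `rfl` on both members) -/

section Pins

variable (F : T4Family) (N : ℕ) [NeZero N] (j : ℕ) (γ ε₀ ε₂₉ B₃ B₃' a₀ a₁ : ℝ)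

/-- `0 < θ₁₅ᶜᶜᴹ(j; γ).τ9.M`. [cite: Balaban1989LargeFieldI, (2.1) p.182 (bookkeeping)] -/
theorem τ9_M_pos_theta13OfThm1CCMW : 0 < (theta13OfThm1CCMW F N j γ ε₀ ε₂₉ B₃ B₃' a₀ a₁).τ9.M := τ9_M_pos_theta13OfThm1CCM F N j ε₀ ε₂₉ B₃ B₃' a₀ a₁

/-- `0 < θ₁₅ᶜᶜᴹ(j; γ).ν.M₁` — the binder `0 < ν.M₁` of the step facts. [cite: Balaban1985RegularSpaces, (1.3)–(1.6) p.77 (bookkeeping)] -/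
theorem M₁_pos_theta13OfThm1CCMW : 0 < (theta13OfThm1CCMW F N j γ ε₀ ε₂₉ B₃ B₃' a₀ a₁).ν.M₁ := M₁_pos_theta13OfThm1CCM F N j ε₀ ε₂₉ B₃ B₃' a₀ a₁

/-- **THE PIN `hM`**: the cube letter is a power of `L` (`⟨j, rfl⟩`). [cite: Balaban1988Convergent, (2.18) p.257, p.245 (bookkeeping)] -/
theorem hM_theta13OfThm1CCMW : ∃ a : ℕ, (theta13OfThm1CCMW F N j γ ε₀ ε₂₉ B₃ B₃' a₀ a₁).τ9.M = F.L ^ a := ⟨j, rfl⟩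

/-- **THE PIN `hM₁`**: `M₁ ∣ M` (`L^j ∣ L^j`). [cite: Balaban1988Convergent, (2.13) p.256, (2.18) p.257 (bookkeeping)] -/
theorem hM₁_theta13OfThm1CCMW : (theta13OfThm1CCMW F N j γ ε₀ ε₂₉ B₃ B₃' a₀ a₁).ν.M₁ ∣ (theta13OfThm1CCMW F N j γ ε₀ ε₂₉ B₃ B₃' a₀ a₁).τ9.M := dvd_refl _

variable {j} in
/-- **★ THE COLLAR LETTER OF THE R-ROAD AT `θ₁₅ᶜᶜᴹ(j; γ)`**: `(11·4 + 3·L)·L ≤ ν.M₁` for every `j ≥ 3` (A2's, window-blind). [cite: Balaban1985RegularSpaces, Prop. 6 p.99, (1.130) p.99, (1.3)–(1.6) p.77; Balaban1985Variational, (144) p.300 (bookkeeping)] -/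
theorem collar_le_M₁_theta13OfThm1CCMW (hj : 3 ≤ j) : (11 * 4 + 3 * F.L) * F.L ≤ (theta13OfThm1CCMW F N j γ ε₀ ε₂₉ B₃ B₃' a₀ a₁).ν.M₁ :=
  collar_le_M₁_theta13OfThm1CCM F N ε₀ ε₂₉ B₃ B₃' a₀ a₁ hj

variable {j} in
/-- The collar letter in the `Setup.Params` letters of every torus of the family. [cite: Balaban1985RegularSpaces, Prop. 6 p.99 (bookkeeping)] -/
theorem collar_le_M₁_theta13OfThm1CCMW' (hj : 3 ≤ j) (K : ℕ) :
    (11 * (F.P K).d + 3 * (F.P K).L) * (F.P K).L ≤ (theta13OfThm1CCMW F N j γ ε₀ ε₂₉ B₃ B₃' a₀ a₁).ν.M₁ :=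
  collar_le_M₁_theta13OfThm1CCMW F N γ ε₀ ε₂₉ B₃ B₃' a₀ a₁ hj

variable {j} in
/-- **★ NO WRAPPING AT `θ₁₅ᶜᶜᴹ(j; γ)` UNDER `j + 1 ≤ F.m`** (A2's, window-blind). [cite: Balaban1987RG1, (0.1) p.251; Balaban1988Convergent, p.257 (bookkeeping)] -/
theorem hsN_theta13OfThm1CCMW (hjm : j + 1 ≤ F.m) :
     ∀ (p : B12.RunParams) (n : ℕ), n ≤ p.K → ∀ n', 1 ≤ n' → n' ≤ n + 1 →
      ((B14.Eq213MaximalDomains.side (F.P p.K).L (theta13OfThm1CCMW F N j γ ε₀ ε₂₉ B₃ B₃' a₀ a₁).τ9.M n' : ℕ) : ℤ) < (F.P p.K).sitesPerDir 0 :=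
  hsN_theta13OfThm1CCM F N ε₀ ε₂₉ B₃ B₃' a₀ a₁ hjm

variable {j} in
/-- **THE CERTIFICATE OF (δ) AT `θ₁₅ᶜᶜᴹ(j; γ)`** (window-blind): if `F.m ≤ j` the top [I]-cube wraps on every run. [cite: Balaban1987RG1, (0.1) p.251; Balaban1988Convergent, p.257 (bookkeeping certificate)] -/
theorem exists_wrap_theta13OfThm1CCMW_of_le (hmj : F.m ≤ j) (p : B12.RunParams) :
    ∃ n n', n ≤ p.K ∧ 1 ≤ n' ∧ n' ≤ n + 1 ∧
      ¬ ((B14.Eq213MaximalDomains.side (F.P p.K).L (theta13OfThm1CCMW F N j γ ε₀ ε₂₉ B₃ B₃' a₀ a₁).τ9.M n' : ℕ) : ℤ) < (F.P p.K).sitesPerDir 0 :=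
  exists_wrap_theta13OfThm1CCM_of_le F N ε₀ ε₂₉ B₃ B₃' a₀ a₁ hmj p

variable {j} in
/-- … so the universally quantified non-wrapping binder fails outright when `F.m ≤ j`. [cite: Balaban1987RG1, (0.1) p.251; Balaban1988Convergent, p.257 (bookkeeping certificate)] -/
theorem not_hsN_theta13OfThm1CCMW_of_le (hmj : F.m ≤ j) (p : B12.RunParams) :
    ¬ ∀ n, n ≤ p.K → ∀ n', 1 ≤ n' → n' ≤ n + 1 →
      ((B14.Eq213MaximalDomains.side (F.P p.K).L (theta13OfThm1CCMW F N j γ ε₀ ε₂₉ B₃ B₃' a₀ a₁).τ9.M n' : ℕ) : ℤ) < (F.P p.K).sitesPerDir 0 :=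
  not_hsN_theta13OfThm1CCM_of_le F N ε₀ ε₂₉ B₃ B₃' a₀ a₁ hmj p

/-- **THE NON-WRAPPING BINDER AT `θ₁₅ᶜᶜᴹ(j; γ)` IS EQUIVALENT TO `j + 1 ≤ F.m`** ((δ) is window-blind). [cite: Balaban1987RG1, (0.1) p.251; Balaban1988Convergent, p.257 (bookkeeping certificate)] -/
theorem hsN_theta13OfThm1CCMW_iff (p : B12.RunParams) :
    (∀ n, n ≤ p.K → ∀ n', 1 ≤ n' → n' ≤ n + 1 →
      ((B14.Eq213MaximalDomains.side (F.P p.K).L (theta13OfThm1CCMW F N j γ ε₀ ε₂₉ B₃ B₃' a₀ a₁).τ9.M n' : ℕ) : ℤ) < (F.P p.K).sitesPerDir 0) ↔ j + 1 ≤ F.m :=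
  hsN_theta13OfThm1CCM_iff F N j ε₀ ε₂₉ B₃ B₃' a₀ a₁ p

end Pins

/-! ## §5. ★★ THE β TRANSFER: on the box `]0, γ]`, `γ ≤ ½`, the β-functions of record of `θ₁₅ᶜᶜᴹ(j; γ)` and of A1's `θ₁₅ᶜᶜᴹ(j)` coincide -/

section Transfer

variable {F : T4Family} {N : ℕ} [NeZero N] {j : ℕ} {γ ε₀ ε₂₉ B₃ B₃' a₀ a₁ : ℝ}

/-- A history in `]0, γ]^{k+1}` is in `]0, γ′]^{k+1}` for `γ ≤ γ′`. [folklore] -/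
private theorem mem_box_of_le {γ γ' : ℝ} (h : γ ≤ γ') {k : ℕ} {v : Fin (k + 1) → ℝ} (hv : v ∈ Box γ k) : v ∈ Box γ' k :=
  FlowStep.mem_box.mpr fun i => ⟨(FlowStep.mem_box.mp hv i).1, (FlowStep.mem_box.mp hv i).2.trans h⟩

/-- **★★ THE β TRANSFER**: for `γ ≤ ½` and every history `v ∈ ]0, γ]^{k+1}`, `β₁₃(θ₁₅ᶜᶜᴹ(j; γ)) k v = β₁₃(θ₁₅ᶜᶜᴹ(j)) k v` — both witnesses carry the same Stage-7 numerics, (2.9)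
threshold, background radius, chart, basis and base histories, so [I] (1.20)–(1.22) on the merged term (1.6) give ONE function `β_merged`, and both box conventions read it on
`]0, γ] ⊆ ]0, ½]` (`betaOfMerged_of_mem`). [cite: Balaban1987RG1, (1.20)–(1.22) p.264, (1.6) p.261, (2.12)–(2.14) p.268] -/
theorem betaOfRecord₁₃_theta13OfThm1CCMW_eq_of_mem (hγ : γ ≤ 1 / 2) {k : ℕ} {v : Fin (k + 1) → ℝ} (hv : v ∈ Box γ k) :
    betaOfRecord₁₃ F N (theta13OfThm1CCMW F N j γ ε₀ ε₂₉ B₃ B₃' a₀ a₁) k v = betaOfRecord₁₃ F N (theta13OfThm1CCM F N j ε₀ ε₂₉ B₃ B₃' a₀ a₁) k v := by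
  have hv' : v ∈ Box (1 / 2 : ℝ) k := mem_box_of_le hγ hv
  show betaOfMerged _ _ γ k v = betaOfMerged _ _ (1 / 2 : ℝ) k v
  rw [betaOfMerged_of_mem _ _ _ hv, betaOfMerged_of_mem _ _ _ hv']
  rfl

/-- **A LOWER β-BOUND OF A1's WITNESS ON `]0, γ]` IS ONE OF THE WINDOW EDITION** (`γ ≤ ½`). [cite: Balaban1987RG1, (1.20)–(1.22) p.264, §1 p.264; Balaban1989LargeFieldII, (1.4) p.357] -/
theorem betaLowerH_theta13OfThm1CCMW_of_half (hγ : γ ≤ 1 / 2) {b : ℝ} (h : BetaLowerH b γ (betaOfRecord₁₃ F N (theta13OfThm1CCM F N j ε₀ ε₂₉ B₃ B₃' a₀ a₁))) :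
    BetaLowerH b γ (betaOfRecord₁₃ F N (theta13OfThm1CCMW F N j γ ε₀ ε₂₉ B₃ B₃' a₀ a₁)) :=
  fun k v hv => by rw [betaOfRecord₁₃_theta13OfThm1CCMW_eq_of_mem hγ hv]; exact h k v hv

/-- **AN UPPER β-BOUND OF A1's WITNESS ON `]0, γ]` IS ONE OF THE WINDOW EDITION** (`γ ≤ ½`). [cite: Balaban1987RG1, (1.20)–(1.22) p.264, §1 p.264 («uniformly bounded»)] -/
theorem betaUpperH_theta13OfThm1CCMW_of_half (hγ : γ ≤ 1 / 2) {β' : ℝ} (h : BetaUpperH β' γ (betaOfRecord₁₃ F N (theta13OfThm1CCM F N j ε₀ ε₂₉ B₃ B₃' a₀ a₁))) :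
    BetaUpperH β' γ (betaOfRecord₁₃ F N (theta13OfThm1CCMW F N j γ ε₀ ε₂₉ B₃ B₃' a₀ a₁)) :=
  fun k v hv => by rw [betaOfRecord₁₃_theta13OfThm1CCMW_eq_of_mem hγ hv]; exact h k v hv

/-- … and conversely (the transfer is an equality on the box). [cite: Balaban1987RG1, (1.20)–(1.22) p.264 (bookkeeping)] -/
theorem betaLowerH_half_of_theta13OfThm1CCMW (hγ : γ ≤ 1 / 2) {b : ℝ} (h : BetaLowerH b γ (betaOfRecord₁₃ F N (theta13OfThm1CCMW F N j γ ε₀ ε₂₉ B₃ B₃' a₀ a₁))) :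
    BetaLowerH b γ (betaOfRecord₁₃ F N (theta13OfThm1CCM F N j ε₀ ε₂₉ B₃ B₃' a₀ a₁)) :=
  fun k v hv => by rw [← betaOfRecord₁₃_theta13OfThm1CCMW_eq_of_mem (j := j) (γ := γ) hγ hv]; exact h k v hv

/-- … and conversely for the upper bound. [cite: Balaban1987RG1, (1.20)–(1.22) p.264 (bookkeeping)] -/
theorem betaUpperH_half_of_theta13OfThm1CCMW (hγ : γ ≤ 1 / 2) {β' : ℝ} (h : BetaUpperH β' γ (betaOfRecord₁₃ F N (theta13OfThm1CCMW F N j γ ε₀ ε₂₉ B₃ B₃' a₀ a₁))) :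
    BetaUpperH β' γ (betaOfRecord₁₃ F N (theta13OfThm1CCM F N j ε₀ ε₂₉ B₃ B₃' a₀ a₁)) :=
  fun k v hv => by rw [← betaOfRecord₁₃_theta13OfThm1CCMW_eq_of_mem (j := j) (γ := γ) hγ hv]; exact h k v hv

/-- A β-box on `]0, ½]` restricts to every smaller box `]0, γ]` (so V15's stub 3′ implies its window weakening). [cite: Balaban1987RG1, §1 p.264 (bookkeeping)] -/
theorem betaBox_restrict_of_le {γ γ' b β' : ℝ} (h : γ ≤ γ') {β : HBeta} (hlow : BetaLowerH b γ' β) (hup : BetaUpperH β' γ' β) :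
    BetaLowerH b γ β ∧ BetaUpperH β' γ β :=
  ⟨fun k v hv => hlow k v (mem_box_of_le h hv), fun k v hv => hup k v (mem_box_of_le h hv)⟩

end Transfer

/-! ## §6. The two history clauses at `θ₁₅ᶜᶜᴹ(j; γ)` from the β-box on `]0, γ]` (13e ∕ 14d are θ-generic), and ★ from the β-box of A1's witness on `]0, γ]` -/

section History

variable {F : T4Family} {N : ℕ} [NeZero N] {j : ℕ} {γ ε₀ ε₂₉ B₃ B₃' a₀ a₁ : ℝ}

/-- **(hmono) AT `θ₁₅ᶜᶜᴹ(j; γ)` from `BetaLowerH b γ β₁₃(θ₁₅ᶜᶜᴹ(j; γ))`, `0 ≤ b`**. [cite: Balaban1987RG1, (0.20) p.256, §1 p.264; Balaban1988Convergent, (2.6) p.255] -/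
theorem hmono_theta13OfThm1CCMW_of_betaLowerH {b : ℝ} (hb : 0 ≤ b) (hlow : BetaLowerH b γ (betaOfRecord₁₃ F N (theta13OfThm1CCMW F N j γ ε₀ ε₂₉ B₃ B₃' a₀ a₁))) :
    ∀ (p : B12.RunParams) (n : ℕ), n ≤ p.K → Step.InInterval (theta13OfThm1CCMW F N j γ ε₀ ε₂₉ B₃ B₃' a₀ a₁).γ n (gOfRecord₁₃ F N (theta13OfThm1CCMW F N j γ ε₀ ε₂₉ B₃ B₃' a₀ a₁) p) → ∀ m, m < n →
      gOfRecord₁₃ F N (theta13OfThm1CCMW F N j γ ε₀ ε₂₉ B₃ B₃' a₀ a₁) p m ≤ gOfRecord₁₃ F N (theta13OfThm1CCMW F N j γ ε₀ ε₂₉ B₃ B₃' a₀ a₁) p (m + 1) :=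
  (theta13OfThm1CCMW F N j γ ε₀ ε₂₉ B₃ B₃' a₀ a₁).hmono_of_betaLowerH hb ((theta13OfThm1CCMW_γ F N j γ ε₀ ε₂₉ B₃ B₃' a₀ a₁).symm ▸ hlow)

/-- **(hcomp) AT `θ₁₅ᶜᶜᴹ(j; γ)` FROM THE β-SIGN LEAF** on `]0, γ]`, `γ ≤ ½`. [cite: Balaban1988Convergent, (2.4) p.255, (2.6)–(2.8) pp.255–256; Balaban1987RG1, (0.20) p.256, §1 p.264] -/
theorem hcomp_theta13OfThm1CCMW_of_betaLowerH (hγ : γ ≤ 1 / 2) (hB : 0 ≤ B₃) (hB' : 0 ≤ B₃') (ha₀ : 0 ≤ a₀) (ha₁ : 0 ≤ a₁)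
    {b : ℝ} (hb : 0 ≤ b) (hlow : BetaLowerH b γ (betaOfRecord₁₃ F N (theta13OfThm1CCMW F N j γ ε₀ ε₂₉ B₃ B₃' a₀ a₁))) :
    ∀ (p : B12.RunParams) (n : ℕ), n ≤ p.K → Step.InInterval (theta13OfThm1CCMW F N j γ ε₀ ε₂₉ B₃ B₃' a₀ a₁).γ n (gOfRecord₁₃ F N (theta13OfThm1CCMW F N j γ ε₀ ε₂₉ B₃ B₃' a₀ a₁) p) → ∀ m, m < n →
      (theta13OfThm1CCMW F N j γ ε₀ ε₂₉ B₃ B₃' a₀ a₁).s2.cR * epsOfRecord (theta13OfThm1CCMW F N j γ ε₀ ε₂₉ B₃ B₃' a₀ a₁).ν (gOfRecord₁₃ F N (theta13OfThm1CCMW F N j γ ε₀ ε₂₉ B₃ B₃' a₀ a₁) p) m ≤ 2 * ((theta13OfThm1CCMW F N j γ ε₀ ε₂₉ B₃ B₃' a₀ a₁).s2.cR * epsOfRecord (theta13OfThm1CCMW F N j γ ε₀ ε₂₉ B₃ B₃' a₀ a₁).ν (gOfRecord₁₃ F N (theta13OfThm1CCMW F N j γ ε₀ ε₂₉ B₃ B₃'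 a₀ a₁) p) (m + 1)) :=
  hcomp_theta13OfThm1CCMW_of_monotone hγ hB hB' ha₀ ha₁ (hmono_theta13OfThm1CCMW_of_betaLowerH hb hlow)

/-- **★★ THE REVERSE COMPARABILITY CLAUSE AT `θ₁₅ᶜᶜᴹ(j; γ)`** (`γ ≤ ½ ≤ 1`, `cR = 1`, `A₀ = A₀ᶜᶜ¹ ≥ 0`) from the β-box on `]0, γ]` with `0 ≤ b` and the 14d letter `β′·γ² ≤ ¾`.
CONDITIONAL on the displayed β-box; nothing of Bałaban asserted. [cite: Balaban1988Convergent, (2.4) p.255, (2.6)–(2.8) pp.255–256; Balaban1987RG1, (0.20) p.256, §1 p.264; Balaban1985Variational, Thm 1 p.279] -/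
theorem hcompRev_theta13OfThm1CCMW_of_betaBox (hγ : γ ≤ 1 / 2) (hB : 0 ≤ B₃) (hB' : 0 ≤ B₃') (ha₀ : 0 ≤ a₀) (ha₁ : 0 ≤ a₁)
    {b β' : ℝ} (hb : 0 ≤ b) (hlow : BetaLowerH b γ (betaOfRecord₁₃ F N (theta13OfThm1CCMW F N j γ ε₀ ε₂₉ B₃ B₃' a₀ a₁)))
    (hup : BetaUpperH β' γ (betaOfRecord₁₃ F N (theta13OfThm1CCMW F N j γ ε₀ ε₂₉ B₃ B₃' a₀ a₁))) (hletter : β' * γ ^ 2 ≤ 3 / 4) :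
    ∀ (p : B12.RunParams) (n : ℕ), n ≤ p.K → Step.InInterval (theta13OfThm1CCMW F N j γ ε₀ ε₂₉ B₃ B₃' a₀ a₁).γ n (gOfRecord₁₃ F N (theta13OfThm1CCMW F N j γ ε₀ ε₂₉ B₃ B₃' a₀ a₁) p) → ∀ m, m < n →
      (theta13OfThm1CCMW F N j γ ε₀ ε₂₉ B₃ B₃' a₀ a₁).s2.cR * epsOfRecord (theta13OfThm1CCMW F N j γ ε₀ ε₂₉ B₃ B₃' a₀ a₁).ν (gOfRecord₁₃ F N (theta13OfThm1CCMW F N j γ ε₀ ε₂₉ B₃ B₃' a₀ a₁) p) (m + 1) ≤ 2 * ((theta13OfThm1CCMW F N j γ ε₀ ε₂₉ B₃ B₃' a₀ a₁).s2.cR * epsOfRecord (theta13OfThm1CCMW F N j γ ε₀ ε₂₉ B₃ B₃' a₀ a₁).ν (gOfRecord₁₃ F N (theta13OfThm1CCMW F N j γ ε₀ ε₂₉ B₃ B₃' a₀ a₁) p) m) :=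
  (theta13OfThm1CCMW F N j γ ε₀ ε₂₉ B₃ B₃' a₀ a₁).hcompRev_of_betaBox (by rw [theta13OfThm1CCMW_A₀]; exact A0OfThm1CC1_nonneg hB hB' ha₀ ha₁)
    (by rw [theta13OfThm1CCMW_γ]; linarith) (by rw [theta13OfThm1CCMW_cR]; norm_num) hb ((theta13OfThm1CCMW_γ F N j γ ε₀ ε₂₉ B₃ B₃' a₀ a₁).symm ▸ hlow)
    ((theta13OfThm1CCMW_γ F N j γ ε₀ ε₂₉ B₃ B₃' a₀ a₁).symm ▸ hup) (by rw [theta13OfThm1CCMW_γ]; exact hletter)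

/-- **★★ (hmono) AT `θ₁₅ᶜᶜᴹ(j; γ)` FROM THE β-SIGN OF A1's WITNESS ON `]0, γ]`** (§5 transfer, `γ ≤ ½`). [cite: Balaban1987RG1, (0.20) p.256, (1.20)–(1.22) p.264; Balaban1989LargeFieldII, (1.4) p.357] -/
theorem hmono_theta13OfThm1CCMW_of_betaLowerH_half (hγ : γ ≤ 1 / 2) {b : ℝ} (hb : 0 ≤ b)
    (hlow : BetaLowerH b γ (betaOfRecord₁₃ F N (theta13OfThm1CCM F N j ε₀ ε₂₉ B₃ B₃' a₀ a₁))) :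
    ∀ (p : B12.RunParams) (n : ℕ), n ≤ p.K → Step.InInterval (theta13OfThm1CCMW F N j γ ε₀ ε₂₉ B₃ B₃' a₀ a₁).γ n (gOfRecord₁₃ F N (theta13OfThm1CCMW F N j γ ε₀ ε₂₉ B₃ B₃' a₀ a₁) p) → ∀ m, m < n →
      gOfRecord₁₃ F N (theta13OfThm1CCMW F N j γ ε₀ ε₂₉ B₃ B₃' a₀ a₁) p m ≤ gOfRecord₁₃ F N (theta13OfThm1CCMW F N j γ ε₀ ε₂₉ B₃ B₃' a₀ a₁) p (m + 1) :=
  hmono_theta13OfThm1CCMW_of_betaLowerH hb (betaLowerH_theta13OfThm1CCMW_of_half hγ hlow)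

/-- **★★ THE REVERSE COMPARABILITY CLAUSE AT `θ₁₅ᶜᶜᴹ(j; γ)` FROM THE β-BOX OF A1's WITNESS ON `]0, γ]`** (`γ ≤ ½`, `0 ≤ b`, `β′·γ² ≤ ¾`; §5 transfer ∘ 14d).
[cite: Balaban1988Convergent, (2.6)–(2.8) pp.255–256; Balaban1987RG1, (0.20) p.256, (1.20)–(1.22) p.264, §1 p.264] -/
theorem hcompRev_theta13OfThm1CCMW_of_betaBox_half (hγ : γ ≤ 1 / 2) (hB : 0 ≤ B₃) (hB' : 0 ≤ B₃') (ha₀ : 0 ≤ a₀) (ha₁ : 0 ≤ a₁)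
    {b β' : ℝ} (hb : 0 ≤ b) (hlow : BetaLowerH b γ (betaOfRecord₁₃ F N (theta13OfThm1CCM F N j ε₀ ε₂₉ B₃ B₃' a₀ a₁)))
    (hup : BetaUpperH β' γ (betaOfRecord₁₃ F N (theta13OfThm1CCM F N j ε₀ ε₂₉ B₃ B₃' a₀ a₁))) (hletter : β' * γ ^ 2 ≤ 3 / 4) :
    ∀ (p : B12.RunParams) (n : ℕ), n ≤ p.K → Step.InInterval (theta13OfThm1CCMW F N j γ ε₀ ε₂₉ B₃ B₃' a₀ a₁).γ n (gOfRecord₁₃ F N (theta13OfThm1CCMW F N j γ ε₀ ε₂₉ B₃ B₃' a₀ a₁) p) → ∀ m, m < n →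
      (theta13OfThm1CCMW F N j γ ε₀ ε₂₉ B₃ B₃' a₀ a₁).s2.cR * epsOfRecord (theta13OfThm1CCMW F N j γ ε₀ ε₂₉ B₃ B₃' a₀ a₁).ν (gOfRecord₁₃ F N (theta13OfThm1CCMW F N j γ ε₀ ε₂₉ B₃ B₃' a₀ a₁) p) (m + 1) ≤ 2 * ((theta13OfThm1CCMW F N j γ ε₀ ε₂₉ B₃ B₃' a₀ a₁).s2.cR * epsOfRecord (theta13OfThm1CCMW F N j γ ε₀ ε₂₉ B₃ B₃' a₀ a₁).ν (gOfRecord₁₃ F N (theta13OfThm1CCMW F N j γ ε₀ ε₂₉ B₃ B₃' a₀ a₁) p) m) :=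
  hcompRev_theta13OfThm1CCMW_of_betaBox hγ hB hB' ha₀ ha₁ hb (betaLowerH_theta13OfThm1CCMW_of_half hγ hlow) (betaUpperH_theta13OfThm1CCMW_of_half hγ hup) hletter

end History

end Literature.MathematicalPhysics.QuantumFieldTheory.Balaban1983to89.Node00

end
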